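import Summits.KontsevichZagierPeriods.KontsevichZagierPeriods.Theorems.RootDecompQuadraticDescentPair18HomotopyP26

/-! # `RootDecompQuadraticDescentPair18HomotopyP27` — part 27/31 of the mechanical ≤400-line split of `Pair18Homotopy_v14_noguard.lean` (sha256 72e9c8442b4af820…)
Source: decomp-kz lens-6 g9 `Pair18Homotopy.lean` v14 (HOME/decomp-kz-lens-6/g9/, sha256 3dda3232…; critic g4-48/g4-53/g4-56/g5 CLEARED; census pair #18 of crux stmt-KontsevichZagierPeriods-28994: homotopy cells, duplications, inversions, Euler–Landen, arc/angle regions; terminal `pair18_g8strips_of_grid : hEuler → hGrid → hAng4 → (g8 form of #18)`); `#guard_msgs … #print axioms` pins removed for landing.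
Split by census-1 g9 `gen/splitlean.py`: scopes re-opened with their `open`/`variable`/`set_option` context; mathematics and declaration order unchanged. -/

set_option linter.unusedSimpArgs false
noncomputable section
open _root_.Set MvPolynomial
namespace Summit.KontsevichZagierPeriods.RootDecompQuadraticDescent.Pair18Homotopy
open Literature.NumberTheory.Transcendental
open Literature.NumberTheory.Transcendental.KZ (RFun cube)
open Summit.KontsevichZagierPeriods.RootDecompQuadraticDescent.DarkPairs (rel_reflect_rep rel_double)

section KSide
open Literature.ModelTheory.ExponentialFields (IsSemialgebraic isSemialgebraic_setOf_eval_le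
  isSemialgebraic_setOf_eval_pos isSemialgebraic_setOf_eval_nonneg isSemialgebraic_setOf_eval_eq_zero)

open _root_.Set MvPolynomial in
open Literature.NumberTheory.Transcendental in
open Literature.NumberTheory.Transcendental.KZ (RFun cube) in
open Summit.KontsevichZagierPeriods.RootDecompQuadraticDescent.DarkPairs (rel_reflect_rep rel_double) in
/-- Auxiliary step `vec2_1` (§2b): vec2 1. [bookkeeping] -/
private theorem vec2_1 (a b : ℝ) : (![a, b] : Fin 2 → ℝ) 1 = b := rfl

open _root_.Set MvPolynomial in
open Literature.NumberTheory.Transcendental in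
open Literature.NumberTheory.Transcendental.KZ (RFun cube) in
open Summit.KontsevichZagierPeriods.RootDecompQuadraticDescent.DarkPairs (rel_reflect_rep rel_double) in
/-- Auxiliary step `vec2_0` (§2b): vec2 0. [bookkeeping] -/
private theorem vec2_0 (a b : ℝ) : (![a, b] : Fin 2 → ℝ) 0 = a := rfl

open _root_.Set MvPolynomial in
open Literature.NumberTheory.Transcendental in
open Literature.NumberTheory.Transcendental.KZ (RFun cube) in
open Summit.KontsevichZagierPeriods.RootDecompQuadraticDescent.DarkPairs (rel_reflect_rep rel_double) in
/-- Auxiliary step `cube2` (§0): cube2. [bookkeeping] -/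
private theorem cube2 {x : Fin 2 → ℝ} (hx : x ∈ KZ.cube 2) : (0 ≤ x 0 ∧ x 0 ≤ 1) ∧ (0 ≤ x 1 ∧ x 1 ≤ 1) := ⟨hx 0, hx 1⟩

/-- **hAng2 ⟸ hAng4.**  With `Shp_ang`, `Shm_ang`, `AngR_twice` the angle-world congruence of §17 is the
SCISSORS CONGRUENCE `μ(RM) + μ(RK₊) + μ(RK₋) = θ² − 2(π/2−θ)²` between three angle–angle boxes with the SAME
weight `AngH = dPdQ/((1+P²)(1+Q²))` (Lebesgue measure in `(arctan P, arctan Q)`) over explicit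
`ℚ`-semialgebraic regions of one plane, and the two currencies `Th7 = θ²`, `B17 = (π/2−θ)²` (integer form). -/
theorem ang2_of_ang4
    (hAng4 : KZ.of AngHM + KZ.of AngHp + KZ.of AngHm - KZ.of Th7.rep + 2 • KZ.of B17.rep ∈ KZ.relations) :
    2 • KZ.of AngR + 4 • KZ.of Shp.rep + 4 • KZ.of Shm.rep - 4 • KZ.of Th7.rep + 8 • KZ.of B17.rep ∈
      KZ.relations := by
  have e : 2 • KZ.of AngR + 4 • KZ.of Shp.rep + 4 • KZ.of Shm.rep - 4 • KZ.of Th7.rep + 8 • KZ.of B17.rep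
      = 4 • (KZ.of AngHM + KZ.of AngHp + KZ.of AngHm - KZ.of Th7.rep + 2 • KZ.of B17.rep)
        + 2 • (KZ.of AngR - 2 • KZ.of AngHM) + 4 • (KZ.of Shp.rep - KZ.of AngHp)
        + 4 • (KZ.of Shm.rep - KZ.of AngHm) := by
    simp only [smul_add, smul_sub, smul_smul]; abel
  rw [e]
  exact add_mem (add_mem (add_mem (KZ.relations.nsmul_mem hAng4 4) (KZ.relations.nsmul_mem AngR_twice 2))
    (KZ.relations.nsmul_mem Shp_ang 4)) (KZ.relations.nsmul_mem Shm_ang 4)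

/-- **#18 ⟸ hBridge ∧ hLog ∧ hAng4** — the `g9` terminal form (v11): the `ζ(2)`-type ANGLE↔LOG bridge,
the log-world identity, and the angle-world SCISSORS CONGRUENCE of three weight-1 angle boxes. -/
theorem pair18_g8strips_of_threeK
    (hBridge : 6 • KZ.of Ax0.rep - KZ.of Th7.rep - KZ.of B17.rep - 2 • KZ.of PB7.rep ∈ KZ.relations)
    (hLog : 2 • KZ.of M2log.rep - KZ.of N7U + 3 • KZ.of Lbox.rep - 3 • KZ.of Lq.rep - KZ.of MT ∈ KZ.relations)
    (hAng4 : KZ.of AngHM + KZ.of AngHp + KZ.of AngHm - KZ.of Th7.rep + 2 • KZ.of B17.rep ∈ KZ.relations) :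
    KZ.of U1.rep - KZ.of U2r.rep + KZ.of SL.rep - 2 • KZ.of K12c.rep + 2 • KZ.of Kh.rep ∈ KZ.relations :=
  pair18_g8strips_of_three hBridge hLog (ang2_of_ang4 hAng4)

end KSide

section Fold
open Literature.ModelTheory.ExponentialFields (IsSemialgebraic isSemialgebraic_setOf_eval_le
  isSemialgebraic_setOf_eval_pos isSemialgebraic_setOf_eval_nonneg isSemialgebraic_setOf_eval_eq_zero)

/-! ### §19 THE FOLD: `[M2log] ≡ [Lhalf]` (`½log²2`), an orientation-cancelling change of variables

`M2log = ∂ₓD/((2+2t)D)`, `D = M2Den = 1 − (1+2t)x + (2+2t)x²` (`D(0)=1`, `D(1)=2`, vertex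
`x_v = (1+2t)/(4+4t)`).  The primitive `log D` is not `ℚ`-semialgebraic, so Newton–Leibniz is not a
move; instead cut the square along the vertex line `(4+4t)x = 1+2t`, map each monotone piece by
`Φ(x,t) = ((16·D − 7)/25, t)` onto the regular box `FT = [□², 25/((2+2t)(25u+7))]` (resp. `−FT` on the
decreasing piece, where `|det DΦ| = −(16/25)∂ₓD`), cancel the two copies over `{25u ≤ 9}` (= `D ≤ 1`)
and identify the rest `{25u ≥ 9}` with `Lhalf` by `u = (9+16x)/25`. -/

/-- Auxiliary step `aeval_M2Den` (§19): aeval M2 Den. [bookkeeping] -/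
theorem aeval_M2Den (z : Fin 2 → ℝ) :
    aeval z M2Den = 1 - (1 + 2 * z 1) * z 0 + (2 + 2 * z 1) * z 0 * z 0 := by
  simp only [M2Den, map_add, map_sub, map_mul, aeval_C, aeval_X, eq_ratCast, Rat.cast_ofNat, Rat.cast_one]

/-- the fold pieces `{∂ₓD ≤ 0}`, `{∂ₓD ≥ 0}` -/
def sF1 : Set (Fin 2 → ℝ) := {z | (4 + 4 * z 1) * z 0 ≤ 1 + 2 * z 1}
/-- Auxiliary definition `sF2` (§19): s F2. [bookkeeping] -/
def sF2 : Set (Fin 2 → ℝ) := {z | 1 + 2 * z 1 ≤ (4 + 4 * z 1) * z 0}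
/-- Auxiliary step `isSemialgebraic_sF1` (§19): is Semialgebraic s F1. [bookkeeping] -/
theorem isSemialgebraic_sF1 : IsSemialgebraic ℚ sF1 :=
  isSemialgebraic_of_le ((C 4 + C 4 * X 1) * X 0) (C 1 + C 2 * X 1) sF1 fun z => by
    simp only [sF1, mem_setOf_eq, map_add, map_mul, aeval_C, aeval_X, eq_ratCast, Rat.cast_ofNat, Rat.cast_one]
/-- Auxiliary step `isSemialgebraic_sF2` (§19): is Semialgebraic s F2. [bookkeeping] -/
theorem isSemialgebraic_sF2 : IsSemialgebraic ℚ sF2 :=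
  isSemialgebraic_of_le (C 1 + C 2 * X 1) ((C 4 + C 4 * X 1) * X 0) sF2 fun z => by
    simp only [sF2, mem_setOf_eq, map_add, map_mul, aeval_C, aeval_X, eq_ratCast, Rat.cast_ofNat, Rat.cast_one]
/-- Auxiliary definition `FP1` (§19): FP1. [bookkeeping] -/
def FP1 : Set (Fin 2 → ℝ) := cube 2 ∩ sF1
/-- Auxiliary definition `FP2` (§19): FP2. [bookkeeping] -/
def FP2 : Set (Fin 2 → ℝ) := cube 2 ∩ sF2
/-- Auxiliary step `isSemialgebraic_FP1` (§19): is Semialgebraic FP1. [bookkeeping] -/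
theorem isSemialgebraic_FP1 : IsSemialgebraic ℚ FP1 := KZ.isSemialgebraic_cube.inter isSemialgebraic_sF1
/-- Auxiliary step `isSemialgebraic_FP2` (§19): is Semialgebraic FP2. [bookkeeping] -/
theorem isSemialgebraic_FP2 : IsSemialgebraic ℚ FP2 := KZ.isSemialgebraic_cube.inter isSemialgebraic_sF2
/-- Auxiliary definition `M2log1` (§19): M2log1. [bookkeeping] -/
def M2log1 : KZ.IntegralRep 2 := M2log.rep.restrict FP1 isSemialgebraic_FP1 (fun _ hz => hz.1)
/-- Auxiliary definition `M2log2` (§19): M2log2. [bookkeeping] -/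
def M2log2 : KZ.IntegralRep 2 := M2log.rep.restrict FP2 isSemialgebraic_FP2 (fun _ hz => hz.1)

/-- Auxiliary step `volume_vertex` (§19): volume vertex. [bookkeeping] -/
theorem volume_vertex :
    MeasureTheory.volume {z : Fin 2 → ℝ | (4 + 4 * z 1) * z 0 = 1 + 2 * z 1} = 0 := by
  have h := volume_setOf_aeval_eq_zero (k := ℚ) (m := 2)
    ((C 4 + C 4 * X 1) * X 0 - (C 1 + C 2 * X 1) : MvPolynomial (Fin 2) ℚ) (by
    intro h0
    have h1 := congr_arg (MvPolynomial.eval ![(0:ℝ), 0]) h0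
    simp at h1)
  have e : {x : Fin 2 → ℝ | aeval x ((C 4 + C 4 * X 1) * X 0 - (C 1 + C 2 * X 1) : MvPolynomial (Fin 2) ℚ) = 0}
      = {z : Fin 2 → ℝ | (4 + 4 * z 1) * z 0 = 1 + 2 * z 1} := by
    ext z
    simp only [mem_setOf_eq, map_sub, map_add, map_mul, aeval_C, aeval_X, eq_ratCast, Rat.cast_ofNat,
      Rat.cast_one, sub_eq_zero]
  rw [e] at h; exact h

/-- the vertex cut `[M2log] ≡ [M2log | ∂ₓD ≤ 0] + [M2log | ∂ₓD ≥ 0]`. -/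
theorem M2log_add : KZ.of M2log.rep - KZ.of M2log1 - KZ.of M2log2 ∈ KZ.relations := by
  refine KZ.domainAddRel_subset_relations
    ⟨2, M2log.rep, M2log1, M2log2, ?_, ?_, fun _ _ => rfl, fun _ _ => rfl, rfl⟩
  · simp only [M2log1, M2log2, KZ.IntegralRep.domain_restrict, RFun.rep_domain, FP1, FP2, sF1, sF2]
    ext z
    simp only [mem_union, mem_inter_iff, mem_setOf_eq]
    constructor
    · intro hz
      rcases le_total ((4 + 4 * z 1) * z 0) (1 + 2 * z 1) with h | h
      · exact Or.inl ⟨hz, h⟩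
      · exact Or.inr ⟨hz, h⟩
    · rintro (⟨hz, _⟩ | ⟨hz, _⟩) <;> exact hz
  · refine MeasureTheory.measure_mono_null ?_ volume_vertex
    simp only [M2log1, M2log2, KZ.IntegralRep.domain_restrict, FP1, FP2, sF1, sF2]
    rintro z ⟨⟨_, h1⟩, ⟨_, h2⟩⟩
    simp only [mem_setOf_eq] at h1 h2 ⊢
    exact le_antisymm h1 h2

/-- the regular target box `FT = [□², 25/((2+2t)(25u+7))]` and its negative `FN`. -/
def FTDen : MvPolynomial (Fin 2) ℚ := (C 2 + C 2 * X 1) * (C 25 * X 0 + C 7)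
/-- Auxiliary step `FTDen_pos` (§19): FTDen pos. [bookkeeping] -/
theorem FTDen_pos {x : Fin 2 → ℝ} (hx : x ∈ KZ.cube 2) : 0 < aeval x FTDen := by
  obtain ⟨h0, h1⟩ := cube2 hx
  simp only [FTDen, map_add, map_mul, aeval_C, aeval_X, eq_ratCast, Rat.cast_ofNat]
  have : (0:ℝ) < 2 + 2 * x 1 := by linarith
  have : (0:ℝ) < 25 * x 0 + 7 := by linarith
  positivity
/-- Auxiliary definition `FT` (§19): FT. [bookkeeping] -/
def FT : RFun 2 := ⟨C 25, FTDen, fun _ hx => (FTDen_pos hx).ne'⟩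
/-- Auxiliary definition `FN` (§19): FN. [bookkeeping] -/
def FN : RFun 2 := ⟨C (-25), FTDen, fun _ hx => (FTDen_pos hx).ne'⟩

/-- the images: `sI = {(25u−9)(1+t) + 2(1+2t)² ≥ 0}` (= `D ≥ D(x_v)`), `sLo = {25u ≤ 9}` (= `D ≤ 1`). -/
def sI : Set (Fin 2 → ℝ) := {z | 0 ≤ (25 * z 0 - 9) * (1 + z 1) + 2 * (1 + 2 * z 1) * (1 + 2 * z 1)}
/-- Auxiliary definition `sLo` (§19): s Lo. [bookkeeping] -/
def sLo : Set (Fin 2 → ℝ) := {z | 25 * z 0 ≤ 9}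
/-- Auxiliary definition `sHi` (§19): s Hi. [bookkeeping] -/
def sHi : Set (Fin 2 → ℝ) := {z | 9 ≤ 25 * z 0}
/-- Auxiliary step `isSemialgebraic_sI` (§19): is Semialgebraic s I. [bookkeeping] -/
theorem isSemialgebraic_sI : IsSemialgebraic ℚ sI :=
  isSemialgebraic_of_le (C 0) ((C 25 * X 0 - C 9) * (C 1 + X 1) + C 2 * (C 1 + C 2 * X 1) * (C 1 + C 2 * X 1)) sI
    fun z => by
    simp only [sI, mem_setOf_eq, map_add, map_sub, map_mul, aeval_C, aeval_X, eq_ratCast, Rat.cast_ofNat,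
      Rat.cast_one, Rat.cast_zero]
/-- Auxiliary step `isSemialgebraic_sLo` (§19): is Semialgebraic s Lo. [bookkeeping] -/
theorem isSemialgebraic_sLo : IsSemialgebraic ℚ sLo :=
  isSemialgebraic_of_le (C 25 * X 0) (C 9) sLo fun z => by
    simp only [sLo, mem_setOf_eq, map_mul, aeval_C, aeval_X, eq_ratCast, Rat.cast_ofNat]
/-- Auxiliary step `isSemialgebraic_sHi` (§19): is Semialgebraic s Hi. [bookkeeping] -/
theorem isSemialgebraic_sHi : IsSemialgebraic ℚ sHi :=
  isSemialgebraic_of_le (C 9) (C 25 * X 0) sHi fun z => by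
    simp only [sHi, mem_setOf_eq, map_mul, aeval_C, aeval_X, eq_ratCast, Rat.cast_ofNat]
/-- Auxiliary definition `FI2` (§19): FI2. [bookkeeping] -/
def FI2 : Set (Fin 2 → ℝ) := cube 2 ∩ sI
/-- Auxiliary definition `FI1` (§19): FI1. [bookkeeping] -/
def FI1 : Set (Fin 2 → ℝ) := cube 2 ∩ sI ∩ sLo
/-- Auxiliary definition `FIB` (§19): FIB. [bookkeeping] -/
def FIB : Set (Fin 2 → ℝ) := cube 2 ∩ sI ∩ sHi
/-- Auxiliary step `isSemialgebraic_FI2` (§19): is Semialgebraic FI2. [bookkeeping] -/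
theorem isSemialgebraic_FI2 : IsSemialgebraic ℚ FI2 := KZ.isSemialgebraic_cube.inter isSemialgebraic_sI
/-- Auxiliary step `isSemialgebraic_FI1` (§19): is Semialgebraic FI1. [bookkeeping] -/
theorem isSemialgebraic_FI1 : IsSemialgebraic ℚ FI1 :=
  (KZ.isSemialgebraic_cube.inter isSemialgebraic_sI).inter isSemialgebraic_sLo
/-- Auxiliary step `isSemialgebraic_FIB` (§19): is Semialgebraic FIB. [bookkeeping] -/
theorem isSemialgebraic_FIB : IsSemialgebraic ℚ FIB :=
  (KZ.isSemialgebraic_cube.inter isSemialgebraic_sI).inter isSemialgebraic_sHi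
/-- Auxiliary definition `FT2` (§19): FT2. [bookkeeping] -/
def FT2 : KZ.IntegralRep 2 := FT.rep.restrict FI2 isSemialgebraic_FI2 (fun _ hz => hz.1)
/-- Auxiliary definition `FT1` (§19): FT1. [bookkeeping] -/
def FT1 : KZ.IntegralRep 2 := FT.rep.restrict FI1 isSemialgebraic_FI1 (fun _ hz => hz.1.1)
/-- Auxiliary definition `FTB` (§19): FTB. [bookkeeping] -/
def FTB : KZ.IntegralRep 2 := FT.rep.restrict FIB isSemialgebraic_FIB (fun _ hz => hz.1.1)
/-- Auxiliary definition `FN1` (§19): FN1. [bookkeeping] -/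
def FN1 : KZ.IntegralRep 2 := FN.rep.restrict FI1 isSemialgebraic_FI1 (fun _ hz => hz.1.1)

/-- Auxiliary step `volume_nine` (§19): volume nine. [bookkeeping] -/
theorem volume_nine : MeasureTheory.volume {z : Fin 2 → ℝ | 25 * z 0 = 9} = 0 := by
  have h := volume_setOf_aeval_eq_zero (k := ℚ) (m := 2) (C 25 * X 0 - C 9 : MvPolynomial (Fin 2) ℚ) (by
    intro h0
    have h1 := congr_arg (MvPolynomial.eval ![(0:ℝ), 0]) h0
    simp at h1)
  have e : {x : Fin 2 → ℝ | aeval x (C 25 * X 0 - C 9 : MvPolynomial (Fin 2) ℚ) = 0}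
      = {z : Fin 2 → ℝ | 25 * z 0 = 9} := by
    ext z
    simp only [mem_setOf_eq, map_sub, map_mul, aeval_C, aeval_X, eq_ratCast, Rat.cast_ofNat, sub_eq_zero]
  rw [e] at h; exact h

/-- `[FT | I₂] ≡ [FT | I₁] + [FT | I₂ ∩ {25u ≥ 9}]`. -/
theorem FT2_add : KZ.of FT2 - KZ.of FT1 - KZ.of FTB ∈ KZ.relations := by
  refine KZ.domainAddRel_subset_relations ⟨2, FT2, FT1, FTB, ?_, ?_, fun _ _ => rfl, fun _ _ => rfl, rfl⟩
  · simp only [FT2, FT1, FTB, KZ.IntegralRep.domain_restrict, FI2, FI1, FIB, sLo, sHi]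
    ext z
    simp only [mem_union, mem_inter_iff, mem_setOf_eq]
    constructor
    · intro hz
      rcases le_total (25 * z 0) 9 with h | h
      · exact Or.inl ⟨hz, h⟩
      · exact Or.inr ⟨hz, h⟩
    · rintro (⟨hz, _⟩ | ⟨hz, _⟩) <;> exact hz
  · refine MeasureTheory.measure_mono_null ?_ volume_nine
    simp only [FT1, FTB, KZ.IntegralRep.domain_restrict, FI1, FIB, sLo, sHi]
    rintro z ⟨⟨_, h1⟩, ⟨_, h2⟩⟩
    simp only [mem_setOf_eq] at h1 h2 ⊢
    exact le_antisymm h1 h2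

/-- the two orientations cancel: `[FT | I₁] + [FN | I₁] ≡ 0`. -/
theorem fold_cancel : KZ.of FT1 + KZ.of FN1 ∈ KZ.relations := by
  obtain ⟨z, hzd, hzi⟩ := KZ.exists_zeroRep (n := 2) isSemialgebraic_FI1
  have h1 : KZ.of z - KZ.of FT1 - KZ.of FN1 ∈ KZ.relations := by
    refine KZ.integrandAddRel_subset_relations ⟨2, z, FT1, FN1, ?_, ?_, fun x _ => ?_, rfl⟩
    · simp only [FT1, KZ.IntegralRep.domain_restrict, hzd]
    · simp only [FN1, KZ.IntegralRep.domain_restrict, hzd]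
    · simp only [hzi, Pi.zero_apply, Pi.add_apply, FT1, FN1, KZ.IntegralRep.integrand_restrict,
        RFun.rep_integrand]
      simp only [FT, FN, FTDen, RFun.fn, map_add, map_mul, map_neg, aeval_C, aeval_X, eq_ratCast,
        Rat.cast_ofNat, Rat.cast_neg]
      ring
  have h2 : KZ.of z ∈ KZ.relations := KZ.of_mem_relations_of_eqOn_zero z (by simp [hzi, EqOn])
  have e : KZ.of FT1 + KZ.of FN1 = KZ.of z - (KZ.of z - KZ.of FT1 - KZ.of FN1) := by abel
  rw [e]; exact sub_mem h2 h1

/-- `[Lhalf] ≡ [FT | 25u ≥ 9]` by the affine map `u = (9+16x)/25`. -/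
theorem Lhalf_FTB : KZ.of Lhalf.rep - KZ.of FTB ∈ KZ.relations := by
  let Φ : (Fin 2 → ℝ) → (Fin 2 → ℝ) := fun z => ![9 / 25 + 16 / 25 * z 0, z 1]
  let Mz : Matrix (Fin 2) (Fin 2) ℝ := !![16 / 25, 0; 0, 1]
  let Φ' : (Fin 2 → ℝ) → (Fin 2 → ℝ) →L[ℝ] (Fin 2 → ℝ) := fun _ =>
    LinearMap.toContinuousLinearMap (Matrix.toLin' Mz)
  have hΦ'ap : ∀ z w, Φ' z w = ![16 / 25 * w 0, w 1] := by
    intro z w; funext i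
    fin_cases i <;> simp [Φ', Mz, Matrix.toLin'_apply, Matrix.mulVec, dotProduct, Fin.sum_univ_two]
  have hdet : ∀ z, (Φ' z).det = 16 / 25 := by
    intro z
    unfold ContinuousLinearMap.det
    simp [Φ', LinearMap.det_toLin', Mz, Matrix.det_fin_two]
  have hdom : FTB.domain = Φ '' Lhalf.rep.domain := by
    simp only [FTB, KZ.IntegralRep.domain_restrict, RFun.rep_domain, FIB, sI, sHi]
    ext w
    constructor
    · rintro ⟨⟨hw, hI⟩, hH⟩
      simp only [mem_setOf_eq] at hI hH
      obtain ⟨hw0, hw1⟩ := cube2 hw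
      refine ⟨![(25 * w 0 - 9) / 16, w 1], ?_, ?_⟩
      · intro i
        fin_cases i
        · simp only [Fin.zero_eta, Matrix.cons_val_zero]
          constructor
          · apply div_nonneg _ (by norm_num); linarith
          · rw [div_le_one (by norm_num)]; linarith
        · simpa using hw1
      · funext i
        fin_cases i
        · simp [Φ]; ring
        · simp [Φ]
    · rintro ⟨z, hz, rfl⟩
      obtain ⟨h0, h1⟩ := cube2 hz
      refine ⟨⟨fun i => ?_, ?_⟩, ?_⟩
      · fin_cases i
        · simp only [Φ, Fin.zero_eta, Matrix.cons_val_zero]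
          constructor <;> linarith
        · simpa [Φ] using h1
      · simp only [mem_setOf_eq, Φ, Matrix.cons_val_zero, Matrix.cons_val_one, Matrix.head_cons]
        nlinarith [mul_nonneg h0.1 h1.1]
      · simp only [mem_setOf_eq, Φ, Matrix.cons_val_zero]
        linarith
  refine KZ.changeOfVariablesRel_subset_relations ⟨2, Lhalf.rep, FTB, Φ, Φ', ?_, ?_, ?_, hdom, ?_, rfl⟩
  · have hsd : IsSemialgebraic ℚ Lhalf.rep.domain := Lhalf.rep.isSemialgebraic_domain
    refine (isSemialgebraicMapOn_iff_forall_holds hsd).mpr fun i => ?_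
    fin_cases i
    · exact (isSemialgebraicFunOn_aeval hsd (C (9 / 25) + C (16 / 25) * X 0)).congr fun z _ => by
        simp [Φ]
    · exact (isSemialgebraicFunOn_aeval hsd (X 1)).congr fun z _ => by simp [Φ]
  · intro z _
    have h0 := ((hasFDerivAt_apply (𝕜 := ℝ) 0 z).const_mul (16 / 25 : ℝ)).const_add (9 / 25 : ℝ)
    have h1 := hasFDerivAt_apply (𝕜 := ℝ) 1 z
    have hpi : HasFDerivAt Φ (Φ' z) z := by
      rw [hasFDerivAt_pi']
      intro i
      fin_cases i
      · refine (h0.congr_fderiv ?_).congr_of_eventuallyEq (Filter.Eventually.of_forall fun y => ?_)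
        · ext w
          simp [hΦ'ap]
        · simp [Φ]
      · refine (h1.congr_fderiv ?_).congr_of_eventuallyEq (Filter.Eventually.of_forall fun y => ?_)
        · ext w
          simp [hΦ'ap]
        · simp [Φ]
    exact hpi.hasFDerivWithinAt
  · intro z₁ _ z₂ _ heq
    have e0 : 9 / 25 + 16 / 25 * z₁ 0 = 9 / 25 + 16 / 25 * z₂ 0 := by simpa [Φ] using congrFun heq 0
    have e1 : z₁ 1 = z₂ 1 := by simpa [Φ] using congrFun heq 1
    funext i
    fin_cases i
    · show z₁ 0 = z₂ 0
      linarith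
    · exact e1
  · intro z hz
    rw [RFun.rep_domain] at hz
    obtain ⟨h0, h1⟩ := cube2 hz
    rw [hdet z, abs_of_pos (by norm_num : (0:ℝ) < 16 / 25)]
    simp only [FTB, KZ.IntegralRep.integrand_restrict, RFun.rep_integrand]
    simp only [Lhalf, FT, FTDen, LhalfDen, RFun.fn, Φ, map_add, map_sub, map_mul, aeval_C, aeval_X,
      eq_ratCast, Rat.cast_one, Rat.cast_ofNat, Rat.cast_div, vec2_0, vec2_1, Matrix.cons_val_zero,
      Matrix.cons_val_one, Matrix.head_cons]
    have ht : (1 : ℝ) + z 1 ≠ 0 := by linarith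
    have hx : (1 : ℝ) + z 0 ≠ 0 := by linarith
    have h2 : (2 : ℝ) + 2 * z 1 ≠ 0 := by linarith
    have h3 : (25 : ℝ) * (9 / 25 + 16 / 25 * z 0) + 7 ≠ 0 := by linarith
    rw [show (25:ℝ) * (9 / 25 + 16 / 25 * z 0) + 7 = 16 * (1 + z 0) by ring,
      show (2:ℝ) + 2 * z 1 = 2 * (1 + z 1) by ring]
    field_simp

/-- Auxiliary step `FP2_facts` (§19): FP2 facts. [bookkeeping] -/
theorem FP2_facts (z : Fin 2 → ℝ) (hz : z ∈ FP2) :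
    (0 ≤ z 0 ∧ z 0 ≤ 1) ∧ (0 ≤ z 1 ∧ z 1 ≤ 1) ∧ 0 < 1 + z 1 ∧
      0 ≤ (4 + 4 * z 1) * z 0 - (1 + 2 * z 1) ∧
      0 < 1 - (1 + 2 * z 1) * z 0 + (2 + 2 * z 1) * z 0 * z 0 ∧
      1 - (1 + 2 * z 1) * z 0 + (2 + 2 * z 1) * z 0 * z 0 ≤ 2 ∧
      7 ≤ 16 * (1 - (1 + 2 * z 1) * z 0 + (2 + 2 * z 1) * z 0 * z 0) := by
  obtain ⟨hzc, hP⟩ := hz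
  obtain ⟨h0, h1⟩ := cube2 hzc
  simp only [sF2, mem_setOf_eq] at hP
  have ht : (0:ℝ) < 1 + z 1 := by linarith
  have hD := M2Den_pos hzc
  rw [aeval_M2Den] at hD
  refine ⟨h0, h1, ht, by linarith, hD, ?_, ?_⟩
  · have e : 1 - (1 + 2 * z 1) * z 0 + (2 + 2 * z 1) * z 0 * z 0 - 2 =
        (z 0 - 1) * ((2 + 2 * z 1) * z 0 + 1) := by ring
    have : (z 0 - 1) * ((2 + 2 * z 1) * z 0 + 1) ≤ 0 :=
      mul_nonpos_of_nonpos_of_nonneg (by linarith) (by nlinarith [mul_nonneg h1.1 h0.1])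
    linarith
  · have key : (16 * (1 - (1 + 2 * z 1) * z 0 + (2 + 2 * z 1) * z 0 * z 0) - 7) * (1 + z 1) =
        2 * (((4 + 4 * z 1) * z 0 - (1 + 2 * z 1)) * ((4 + 4 * z 1) * z 0 - (1 + 2 * z 1))) +
          (7 + 8 * z 1) * (1 - z 1) := by ring
    have hpos : 0 ≤ 2 * (((4 + 4 * z 1) * z 0 - (1 + 2 * z 1)) * ((4 + 4 * z 1) * z 0 - (1 + 2 * z 1))) +
        (7 + 8 * z 1) * (1 - z 1) :=
      add_nonneg (mul_nonneg (by norm_num) (mul_self_nonneg _)) (mul_nonneg (by linarith) (by linarith))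
    have h3 : 0 ≤ (16 * (1 - (1 + 2 * z 1) * z 0 + (2 + 2 * z 1) * z 0 * z 0) - 7) * (1 + z 1) := by
      rw [key]; exact hpos
    have h4 := (mul_nonneg_iff_of_pos_right ht).mp h3
    linarith

end Fold
end Summit.KontsevichZagierPeriods.RootDecompQuadraticDescent.Pair18Homotopy
end
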